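import Summits.QuantumFields.BalabanUV.Beta.RootedGaugeCovariance
import Summits.QuantumFields.BalabanUV.Beta.RootedMixedJetContact

/-!
# `BalabanUV.Beta.MixedJetWard` — binder row D1, «GAUGE-LETTERS» (G2): **THE JET-LEVEL WARD IDENTITY OF node 12b's ROOTED MIXED JET**
# `MjetAt ρ` under a pure-gauge background, EXACT, in counts (β sub-cell, BINDER-OWNERS row D1 OWNER, lineage an2 gen 21)

HONEST FRAMING (cell charter, verbatim): «discharging BetaPertH makes Balaban's UV stability UNCONDITIONAL — a real
constructive-QFT result; it is NOT the continuum limit and NOT the Clay problem.»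
HONEST DEPENDENCY: continuum YM on T⁴ ⇐ BetaPertH ∧ nine spine estimates (0/9 proved); BetaPertH ⇐ (D1) ∧ (D4) ∧ CAP+tail;
G-an2-4 gates asym, D1 and NE2/3/4.
DERIVED cell leaf ([folklore] ring algebra in node 12's `Rho 𝔸 = (Tau 𝔸)[σ]`, BY NAME over G1 `RootedGaugeCovariance.PhiGAt_gauge`, an3's MX1∕33M1∕33M2∕33M3a∕33M3b
(`GmL`∕`GmbL`∕`PhiMLAt`, `MσGAt`∕`MσLAt` + additivity∕centrality, `mk_sub_ι`, `c11_logT_PhiGAt_Zf`, `c··_MσGAt_contact`) and leaf-05's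
`TruncatedNil4Calculus`).  No statement of Bałaban's papers (B7 (11) is an object LOCATOR), no `[cite:]`, no `Prop` fact; four `def`s are NAMES
of explicit letters.  Second module of the owner's route to the hW-side bond laws of row D1 (journal «GAUGE-LETTERS» (G1)–(G4); display (S) certified
at element level by an1-g29 «W-ELEM», journal l.17457∕l.17518 — EVIDENCE for the statement, the content below is kernel-proved).  Discharges NO letter
by itself; 0∕4 binders (hW, hR, D1Tel, D1Rep).  NOT D1, NOT `BetaPertH`, NOT continuum, NOT Clay.

THE MECHANISM.  Take the background gauge transformation `u(x) = 1 + σ·λ(x)·D` (`λ` scalar, `D ∈ 𝔸`; `u·ū = 1` exactly since `σ² = 0`).  On the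
mixed chart `U_f = Z_f(1 + σB_f)` the transformed configuration is AGAIN a mixed left chart (§2): group part `Z_f` unchanged, background
`B_f − (dλ)_f·D + βg_f`, `βg_f = Z̄_f·(λ(x_f)D)·Z_f − λ(x_f)D` (a `Tau`-valued letter: `τ₁[a,W] + τ₂[a,V] + τ₁τ₂(ah + ha − WaV − VaW)`,
`a = λ(x_f)D`, `h = ½(WV+VW)`); the reference `E_f = 1 + σB_f` becomes `1 + σ(B_f − (dλ)_f D)`.  G1's mother identity `Φ(U^u) = u(r)·Φ(U)·ū(r′)`
(`r` the root, `r′ = r + L·e_μ`) and the exact inverse calculus give `logT(Φ(U^u)·invT Φ(E^u)) = u(r)·logT(Φ(U)·invT Φ(E))·ū(r)` (§3), whose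
σ-part, split by the additivity of an3's two-background σ-jet, is the WARD IDENTITY (§4).

WHAT:
* §1 [our objects] `ug`∕`ugb` (the gauge pair), `dS` (the pure-gauge background `ι((λ(x+e_κ) − λ x)•D)`), `βg` (the letter-rotation defect);
  `ug_mul_ugb`, `ugb_mul_ug`, `βg_zero_zero`.
* §2 the chart lemmas `gaugeF_GmL`, `gaugeB_GmbL` (any `Tau`-valued background `b`; characteristic ≠ 2), `augR_GmL_Zf`∕`augR_GmbL_Zb`.
* §3 `PhiMLAt_gauge` (the mother identity on the mixed left chart), `invT_conj_gauge`, **`logT_quot_gauge`**.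
* §4 **`MσLAt_dS`**: `MσLAt ρ Z Z̄ Z₀ Z̄₀ dS = MσGAt ρ Z Z̄ βg Z₀ Z̄₀ 0 − (ι(λ r•D)·J₀ − J₀·ι(λ r•D))`, `J₀ = logT Φ^ρ(Zf W V, Zb W V)`
  (every `τ`-degree); §5 **`MjetAt_gauge_counts`**: the `τ₁τ₂σ`-coefficient in COUNTS —
  `MjetAt ρ W V dλD = (2L^d)⁻¹•(hessUAt ρ V β₁ + linAvgAt ρ [V,β₁] + hessUAt ρ W β₂ + linAvgAt ρ [W,β₂]) + L^{-d}•linAvgAt ρ β₃ − (λ r•D)·H + H·(λ r•D)`,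
  `H = (2L^d)⁻¹•hessUAt ρ W V`, `β₁ = [a,W]`, `β₂ = [a,V]`, `β₃ = ah + ha − WaV − VaW`.
Provenance: β sub-cell, unit beta-an2 gen 21, 2026-08-20 (v1); no existing file touched.
-/

namespace Summit.QuantumFields.BalabanUV.Beta.MixedJetWard

open Finset
open Literature.MathematicalPhysics.QuantumFieldTheory.Balaban1983to89
open Literature.MathematicalPhysics.QuantumFieldTheory.Balaban1983to89.Beta
open AffineAveraging (Form1 box unitVec)
open AveragingContoursRooted (ctr linAvgAt loopCAt)
open AveragingHessianKernels (bw)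
open AveragingHessianKernelsRooted (hessUAt)
open AveragingThirdJet (Tau Rho dmk fst_dmk snd_dmk dfst_mul dsnd_mul upF upF_apply logT invT expT map_logT map_invT invT_one logT_one
  ι_zero augR augR_apply gaugeF gaugeB logT_conj)
open AveragingThirdJet.Tau (τ₁ τ₂ τ12 ι c00 c10 c01 c11 mk ext4 c11_add c11_neg c11_sub c11_smul c00_mk c10_mk c01_mk c11_mk c00_ι c11_ι_mul c11_mul_ι
  c11_τ₁_mul c11_τ₂_mul c11_τ12_mul τ₁_comm τ₂_comm τ12_comm c00_mul c10_mul c01_mul c11_mul c00_one)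
open AveragingMixedJetTables (PhiGAt map_PhiGAt PhiGAt_one Zf Zb MjetAt)
open Summit.QuantumFields.BalabanUV.Beta.TruncatedNil4Calculus (nil4_augR aug_PhiGAt_eq_one mul_invT_eq_one eq_invT_of_mul_eq_one)
open Summit.QuantumFields.BalabanUV.Beta.RootedMixedChartReflection (GmL GmbL PhiMLAt MσLAt fst_GmL snd_GmL fst_GmbL snd_GmbL Zf_mul_Zb Zb_mul_Zf
  MjetAt_eq_MjetLAt MjetLAt_eq_c11 Zb_mul_ι_mul_Zf)
open Summit.QuantumFields.BalabanUV.Beta.RootedMixedJetLinear (MσGAt MσLAt_eq_MσGAt MσGAt_eq_MσLAt_add MσLAt_sub MσGAt_add_zero MσGAt_mul_central_zero)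
open Summit.QuantumFields.BalabanUV.Beta.RootedMixedJetReflectionLaw (Zf_zero Zb_zero fst_PhiMLAt fst_logT mk_sub_ι)
open Summit.QuantumFields.BalabanUV.Beta.RootedMixedJetContact (c10_MσGAt_contact c01_MσGAt_contact c00_MσGAt_contact)
open Summit.QuantumFields.BalabanUV.Beta.RootedGaugeCovariance (PhiGAt_gauge)
open Summit.QuantumFields.BalabanUV.Beta.RootedJetDictionary (c11_logT_PhiGAt_Zf)

variable {𝕜 : Type*} [Field 𝕜] {d : ℕ} {𝔸 : Type*} [Ring 𝔸] [Algebra 𝕜 𝔸]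

/-! ## §1 The gauge pair, the pure-gauge background and the letter-rotation defect -/

/-- [our object] THE BACKGROUND GAUGE TRANSFORMATION `u(x) = 1 + σ·λ(x)·D` as a site function into `Rho 𝔸`. -/
def ug (lam : (Fin d → ℤ) → 𝕜) (D : 𝔸) : (Fin d → ℤ) → Rho 𝔸 := fun x => dmk 1 (ι (lam x • D))

/-- [our object] Its two-sided inverse `ū(x) = 1 − σ·λ(x)·D`. -/
def ugb (lam : (Fin d → ℤ) → 𝕜) (D : 𝔸) : (Fin d → ℤ) → Rho 𝔸 := fun x => dmk 1 (-ι (lam x • D))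

/-- [our object] THE PURE-GAUGE BACKGROUND LETTER `dS_f = ι((λ(x_f + e_κ) − λ(x_f))•D)` (`Tau`-valued, scalar part only). -/
def dS (lam : (Fin d → ℤ) → 𝕜) (D : 𝔸) : Form1 d (Tau 𝔸) := fun κ x => ι ((lam (x + unitVec κ) - lam x) • D)

/-- [our object] THE LETTER-ROTATION DEFECT `βg_f = Z̄_f·ι(λ(x_f)D)·Z_f − ι(λ(x_f)D)` of the fluctuation pair `(Zf W V, Zb W V)`. -/
noncomputable def βg (lam : (Fin d → ℤ) → 𝕜) (D : 𝔸) (W V : Form1 d 𝔸) : Form1 d (Tau 𝔸) := fun κ x =>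
  Zb 𝕜 W V κ x * ι (lam x • D) * Zf 𝕜 W V κ x - ι (lam x • D)

variable (lam : (Fin d → ℤ) → 𝕜) (D : 𝔸)

/-- [folklore] `u(x)·ū(x) = 1` (exact: `σ² = 0`). -/
theorem ug_mul_ugb (x : Fin d → ℤ) : ug lam D x * ugb lam D x = 1 :=
  TrivSqZeroExt.ext (by simp [ug, ugb]) (by simp [ug, ugb])

/-- [folklore] `ū(x)·u(x) = 1`. -/
theorem ugb_mul_ug (x : Fin d → ℤ) : ugb lam D x * ug lam D x = 1 :=
  TrivSqZeroExt.ext (by simp [ug, ugb]) (by simp [ug, ugb])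

/-- [folklore] `augR u(x) = 1`. -/
theorem augR_ug (x : Fin d → ℤ) : augR 𝕜 (ug lam D x) = 1 := by simp [ug]

/-- [folklore] `augR ū(x) = 1`. -/
theorem augR_ugb (x : Fin d → ℤ) : augR 𝕜 (ugb lam D x) = 1 := by simp [ugb]

/-- [folklore] The defect vanishes for the trivial fluctuation pair (`W = V = 0`: `Zf 0 0 = Zb 0 0 = 1`). -/
theorem βg_zero_zero : βg lam D (0 : Form1 d 𝔸) 0 = 0 := by
  funext κ x
  simp only [βg, Zf_zero, Zb_zero, one_mul, mul_one, sub_self, Pi.zero_apply]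

/-- [folklore] `ι` respects subtraction. -/
theorem ι_sub (a b : 𝔸) : (ι (a - b) : Tau 𝔸) = ι a - ι b :=
  TrivSqZeroExt.ext (TrivSqZeroExt.ext rfl (by simp [ι, Tau.mk])) (TrivSqZeroExt.ext (by simp [ι, Tau.mk]) (by simp [ι, Tau.mk]))

/-- [folklore] The pure-gauge letter is a difference of the two end values. -/
theorem dS_apply (κ : Fin d) (x : Fin d → ℤ) : dS lam D κ x = ι (lam (x + unitVec κ) • D) - ι (lam x • D) := by
  rw [dS, sub_smul, ι_sub]

/-! ## §2 The gauge-transformed mixed left chart is a mixed left chart -/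

/-- [folklore] **FORWARD LETTER**: `u(x)·Z_f(1 + σb_f)·ū(x + e_κ) = Z_f·(1 + σ(b_f − dS_f + βg_f))` (any `Tau`-valued background `b`; uses `Zf·Zb = 1`). -/
theorem gaugeF_GmL (h2 : (2 : 𝕜) ≠ 0) (W V : Form1 d 𝔸) (b : Form1 d (Tau 𝔸)) :
    gaugeF (ug lam D) (ugb lam D) (GmL (Zf 𝕜 W V) b) = GmL (Zf 𝕜 W V) (b - dS lam D + βg lam D W V) := by
  funext κ x
  have hZ := Zf_mul_Zb h2 W V κ x
  refine TrivSqZeroExt.ext ?_ ?_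
  · simp [gaugeF, ug, ugb, fst_GmL]
  · have e : Zf 𝕜 W V κ x * (Zb 𝕜 W V κ x * ι (lam x • D) * Zf 𝕜 W V κ x) = ι (lam x • D) * Zf 𝕜 W V κ x := by
      rw [← mul_assoc, ← mul_assoc, hZ, one_mul]
    simp only [gaugeF, ug, ugb, dsnd_mul, dfst_mul, fst_GmL, snd_GmL, fst_dmk, snd_dmk, one_mul, mul_one, Pi.add_apply, Pi.sub_apply,
      dS_apply, βg, mul_add, mul_sub, e, mul_neg]
    abel

/-- [folklore] **BACKWARD LETTER**: `u(x + e_κ)·(1 − σb_f)Z̄_f·ū(x) = (1 − σ(b_f − dS_f + βg_f))·Z̄_f` (uses `Zf·Zb = 1`). -/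
theorem gaugeB_GmbL (h2 : (2 : 𝕜) ≠ 0) (W V : Form1 d 𝔸) (b : Form1 d (Tau 𝔸)) :
    gaugeB (ug lam D) (ugb lam D) (GmbL (Zb 𝕜 W V) b) = GmbL (Zb 𝕜 W V) (b - dS lam D + βg lam D W V) := by
  funext κ x
  have hZ := Zf_mul_Zb h2 W V κ x
  refine TrivSqZeroExt.ext ?_ ?_
  · simp [gaugeB, ug, ugb, fst_GmbL]
  · have e : Zb 𝕜 W V κ x * ι (lam x • D) * Zf 𝕜 W V κ x * Zb 𝕜 W V κ x = Zb 𝕜 W V κ x * ι (lam x • D) := by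
      rw [mul_assoc, hZ, mul_one]
    simp only [gaugeB, ug, ugb, dsnd_mul, dfst_mul, fst_GmbL, snd_GmbL, fst_dmk, snd_dmk, one_mul, mul_one, Pi.add_apply, Pi.sub_apply,
      dS_apply, βg, add_mul, sub_mul, e, mul_neg, neg_add, neg_sub]
    abel

/-- [folklore] The forward letters of the mixed left chart over `Zf W V` have augmentation one. -/
theorem augR_GmL_Zf (W V : Form1 d 𝔸) (b : Form1 d (Tau 𝔸)) (κ : Fin d) (x : Fin d → ℤ) : augR 𝕜 (GmL (Zf 𝕜 W V) b κ x) = 1 := by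
  rw [augR_apply, fst_GmL]; rfl

/-- [folklore] The backward letters likewise. -/
theorem augR_GmbL_Zb (W V : Form1 d 𝔸) (b : Form1 d (Tau 𝔸)) (κ : Fin d) (x : Fin d → ℤ) : augR 𝕜 (GmbL (Zb 𝕜 W V) b κ x) = 1 := by
  rw [augR_apply, fst_GmbL]; rfl

/-! ## §3 The mother identity on the mixed left chart and the conjugated quotient -/

/-- [folklore] **THE MOTHER IDENTITY ON THE MIXED LEFT CHART**: `Φ^L_ρ(Z, Z̄; b − dS + βg) = u(r)·Φ^L_ρ(Z, Z̄; b)·ū(r + L·e_μ)`, `r = L·y + ρ`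
(G1 `PhiGAt_gauge` over `Rho 𝔸` + §2). -/
theorem PhiMLAt_gauge (h2 : (2 : 𝕜) ≠ 0) (ρ : Fin d → ℤ) (W V : Form1 d 𝔸) (b : Form1 d (Tau 𝔸)) (L : ℕ) (μ : Fin d) (y : Fin d → ℤ) :
    PhiMLAt 𝕜 ρ (Zf 𝕜 W V) (Zb 𝕜 W V) (b - dS lam D + βg lam D W V) L μ y
      = ug lam D ((L : ℤ) • y + ρ) * PhiMLAt 𝕜 ρ (Zf 𝕜 W V) (Zb 𝕜 W V) b L μ y * ugb lam D ((L : ℤ) • y + ρ + (L : ℤ) • unitVec μ) := by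
  rw [PhiMLAt, PhiMLAt, ← gaugeF_GmL lam D h2 W V b, ← gaugeB_GmbL lam D h2 W V b]
  exact PhiGAt_gauge (ug_mul_ugb lam D) (ugb_mul_ug lam D) ρ L μ y

/-- [folklore] The reference case `W = V = 0`: `Φ^L_ρ(1, 1; b − dS) = u(r)·Φ^L_ρ(1, 1; b)·ū(r′)`. -/
theorem PhiMLAt_gauge_ref (h2 : (2 : 𝕜) ≠ 0) (ρ : Fin d → ℤ) (b : Form1 d (Tau 𝔸)) (L : ℕ) (μ : Fin d) (y : Fin d → ℤ) :
    PhiMLAt 𝕜 ρ (Zf 𝕜 (0 : Form1 d 𝔸) 0) (Zb 𝕜 (0 : Form1 d 𝔸) 0) (b - dS lam D) L μ y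
      = ug lam D ((L : ℤ) • y + ρ) * PhiMLAt 𝕜 ρ (Zf 𝕜 (0 : Form1 d 𝔸) 0) (Zb 𝕜 (0 : Form1 d 𝔸) 0) b L μ y
        * ugb lam D ((L : ℤ) • y + ρ + (L : ℤ) • unitVec μ) := by
  have h := PhiMLAt_gauge lam D h2 ρ (0 : Form1 d 𝔸) 0 b L μ y
  rwa [βg_zero_zero, add_zero] at h

/-- [folklore] The mixed left-chart averaging over `Zf W V` has augmentation one (so its truncated inverse is exact; leaf-05's `nil4_augR`). -/
theorem augR_PhiMLAt (ρ : Fin d → ℤ) (W V : Form1 d 𝔸) (b : Form1 d (Tau 𝔸)) (L : ℕ) (μ : Fin d) (y : Fin d → ℤ) :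
    augR 𝕜 (PhiMLAt 𝕜 ρ (Zf 𝕜 W V) (Zb 𝕜 W V) b L μ y) = 1 :=
  aug_PhiGAt_eq_one (augR_GmL_Zf W V b) (augR_GmbL_Zb W V b) ρ L μ y

set_option maxHeartbeats 800000 in
/-- [folklore] **THE INVERSE OF A GAUGE-CONJUGATE**: `invT (u(r)·Φ·ū(r′)) = u(r′)·invT Φ·ū(r)` for `Φ` of augmentation one. -/
theorem invT_conj_gauge {Φ : Rho 𝔸} (hΦ : augR 𝕜 Φ = 1) (r r' : Fin d → ℤ) :
    invT (ug lam D r * Φ * ugb lam D r') = ug lam D r' * invT Φ * ugb lam D r := by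
  have hg : augR 𝕜 (ug lam D r * Φ * ugb lam D r') = 1 := by
    rw [map_mul, map_mul, hΦ, augR_ug, augR_ugb, mul_one, mul_one]
  have h1 : Φ * invT Φ = 1 := mul_invT_eq_one (nil4_augR (𝕜 := 𝕜)) hΦ
  have hv : ug lam D r * Φ * ugb lam D r' * (ug lam D r' * invT Φ * ugb lam D r) = 1 := by
    calc ug lam D r * Φ * ugb lam D r' * (ug lam D r' * invT Φ * ugb lam D r)
        = ug lam D r * Φ * (ugb lam D r' * ug lam D r') * invT Φ * ugb lam D r := by simp only [mul_assoc]
      _ = ug lam D r * (Φ * invT Φ) * ugb lam D r := by rw [ugb_mul_ug, mul_one]; simp only [mul_assoc]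
      _ = 1 := by rw [h1, mul_one, ug_mul_ugb]
  have key : ug lam D r' * invT Φ * ugb lam D r = invT (ug lam D r * Φ * ugb lam D r') :=
    eq_invT_of_mul_eq_one (R := Rho 𝔸) (ag := augR 𝕜) nil4_augR hg hv
  exact key.symm

/-- [folklore] **THE LOGARITHMIC QUOTIENT IS CONJUGATED AT THE ROOT ONLY**: for `Φ`, `Φ₀` of augmentation one,
`logT((uΦū′)·invT(uΦ₀ū′)) = u(r)·logT(Φ·invT Φ₀)·ū(r)` — the far gauge factor cancels. -/
theorem logT_quot_gauge {Φ Φ₀ : Rho 𝔸} (hΦ₀ : augR 𝕜 Φ₀ = 1) (r r' : Fin d → ℤ) :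
    logT 𝕜 ((ug lam D r * Φ * ugb lam D r') * invT (ug lam D r * Φ₀ * ugb lam D r'))
      = ug lam D r * logT 𝕜 (Φ * invT Φ₀) * ugb lam D r := by
  rw [invT_conj_gauge lam D hΦ₀]
  have e : ug lam D r * Φ * ugb lam D r' * (ug lam D r' * invT Φ₀ * ugb lam D r) = ug lam D r * (Φ * invT Φ₀) * ugb lam D r := by
    calc ug lam D r * Φ * ugb lam D r' * (ug lam D r' * invT Φ₀ * ugb lam D r)
        = ug lam D r * Φ * (ugb lam D r' * ug lam D r') * invT Φ₀ * ugb lam D r := by simp only [mul_assoc]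
      _ = ug lam D r * (Φ * invT Φ₀) * ugb lam D r := by rw [ugb_mul_ug, mul_one]; simp only [mul_assoc]
  rw [e, logT_conj (ug_mul_ugb lam D r) (ugb_mul_ug lam D r)]

/-! ## §4 The σ-jet Ward identity (every `τ`-degree) -/

/-- [folklore] The σ-part of a root conjugation: `((1 + σs)·J·(1 − σs)).snd = J.snd + s·J.fst − J.fst·s`. -/
theorem snd_conj_ug (J : Rho 𝔸) (r : Fin d → ℤ) :
    (ug lam D r * J * ugb lam D r).snd = J.snd + ι (lam r • D) * J.fst - J.fst * ι (lam r • D) := by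
  simp only [ug, ugb, dsnd_mul, dfst_mul, fst_dmk, snd_dmk, one_mul, mul_one, mul_neg]
  abel

/-- [folklore] **THE σ-JET WARD IDENTITY OF THE MIXED LEFT CHART** (every `τ`-degree): for `Z = Zf W V`, `Z̄ = Zb W V`, reference `Z₀ = Z̄₀ = 1`
(`= Zf 0 0`, `Zb 0 0`) and any background `b`,
`MσLAt ρ Z Z̄ Z₀ Z̄₀ dS = MσGAt ρ Z Z̄ βg Z₀ Z̄₀ 0 − (ι(λ r•D)·J₀ − J₀·ι(λ r•D))`, `J₀ = logT Φ^ρ(Zf W V, Zb W V)`. -/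
theorem MσLAt_dS (h2 : (2 : 𝕜) ≠ 0) (ρ : Fin d → ℤ) (W V : Form1 d 𝔸) (b : Form1 d (Tau 𝔸)) (L : ℕ) (μ : Fin d) (y : Fin d → ℤ) :
    MσLAt 𝕜 ρ (Zf 𝕜 W V) (Zb 𝕜 W V) (Zf 𝕜 0 0) (Zb 𝕜 0 0) (dS lam D) L μ y
      = MσGAt 𝕜 ρ (Zf 𝕜 W V) (Zb 𝕜 W V) (βg lam D W V) (Zf 𝕜 0 0) (Zb 𝕜 0 0) 0 L μ y
        - (ι (lam ((L : ℤ) • y + ρ) • D) * logT 𝕜 (PhiGAt 𝕜 ρ (Zf 𝕜 W V) (Zb 𝕜 W V) L μ y)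
           - logT 𝕜 (PhiGAt 𝕜 ρ (Zf 𝕜 W V) (Zb 𝕜 W V) L μ y) * ι (lam ((L : ℤ) • y + ρ) • D)) := by
  -- the two-background σ-jet of the gauge-transformed pair, computed twice
  set r : Fin d → ℤ := (L : ℤ) • y + ρ with hr
  set r' : Fin d → ℤ := (L : ℤ) • y + ρ + (L : ℤ) • unitVec μ with hr'
  set Φ := PhiMLAt 𝕜 ρ (Zf 𝕜 W V) (Zb 𝕜 W V) b L μ y with hΦ
  set Φ₀ := PhiMLAt 𝕜 ρ (Zf 𝕜 (0 : Form1 d 𝔸) 0) (Zb 𝕜 (0 : Form1 d 𝔸) 0) b L μ y with hΦ₀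
  have key : MσGAt 𝕜 ρ (Zf 𝕜 W V) (Zb 𝕜 W V) (b - dS lam D + βg lam D W V) (Zf 𝕜 0 0) (Zb 𝕜 0 0) (b - dS lam D) L μ y
      = (ug lam D r * logT 𝕜 (Φ * invT Φ₀) * ugb lam D r).snd := by
    rw [MσGAt, PhiMLAt_gauge lam D h2, PhiMLAt_gauge_ref lam D h2, logT_quot_gauge lam D (augR_PhiMLAt ρ 0 0 b L μ y)]
  -- left side: additivity in the two backgrounds
  have lhs : MσGAt 𝕜 ρ (Zf 𝕜 W V) (Zb 𝕜 W V) (b - dS lam D + βg lam D W V) (Zf 𝕜 0 0) (Zb 𝕜 0 0) (b - dS lam D) L μ y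
      = MσLAt 𝕜 ρ (Zf 𝕜 W V) (Zb 𝕜 W V) (Zf 𝕜 0 0) (Zb 𝕜 0 0) b L μ y
          - MσLAt 𝕜 ρ (Zf 𝕜 W V) (Zb 𝕜 W V) (Zf 𝕜 0 0) (Zb 𝕜 0 0) (dS lam D) L μ y
          + MσGAt 𝕜 ρ (Zf 𝕜 W V) (Zb 𝕜 W V) (βg lam D W V) (Zf 𝕜 0 0) (Zb 𝕜 0 0) 0 L μ y := by
    rw [MσGAt_eq_MσLAt_add, MσLAt_sub]
  -- right side: the σ-part of the root conjugation
  have rhs : (ug lam D r * logT 𝕜 (Φ * invT Φ₀) * ugb lam D r).snd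
      = MσLAt 𝕜 ρ (Zf 𝕜 W V) (Zb 𝕜 W V) (Zf 𝕜 0 0) (Zb 𝕜 0 0) b L μ y
          + (ι (lam r • D) * logT 𝕜 (PhiGAt 𝕜 ρ (Zf 𝕜 W V) (Zb 𝕜 W V) L μ y)
              - logT 𝕜 (PhiGAt 𝕜 ρ (Zf 𝕜 W V) (Zb 𝕜 W V) L μ y) * ι (lam r • D)) := by
    have hfst : (logT 𝕜 (Φ * invT Φ₀)).fst = logT 𝕜 (PhiGAt 𝕜 ρ (Zf 𝕜 W V) (Zb 𝕜 W V) L μ y) := by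
      have h0 : Φ₀.fst = 1 := by rw [hΦ₀, fst_PhiMLAt, Zf_zero, Zb_zero, PhiGAt_one]
      rw [fst_logT, dfst_mul, hΦ, fst_PhiMLAt,
        Summit.QuantumFields.BalabanUV.Beta.RootedMixedJetReflectionLaw.fst_invT_of_fst_eq_one h0, mul_one]
    rw [snd_conj_ug, hfst]
    have hsnd : (logT 𝕜 (Φ * invT Φ₀)).snd = MσLAt 𝕜 ρ (Zf 𝕜 W V) (Zb 𝕜 W V) (Zf 𝕜 0 0) (Zb 𝕜 0 0) b L μ y := by
      rw [MσLAt, hΦ, hΦ₀]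
    rw [hsnd]
    abel
  have h3 := key
  rw [lhs, rhs] at h3
  -- solve for the pure-gauge jet: from `A − X + G = A + C` get `X = G − C`
  set A := MσLAt 𝕜 ρ (Zf 𝕜 W V) (Zb 𝕜 W V) (Zf 𝕜 0 0) (Zb 𝕜 0 0) b L μ y
  set X := MσLAt 𝕜 ρ (Zf 𝕜 W V) (Zb 𝕜 W V) (Zf 𝕜 0 0) (Zb 𝕜 0 0) (dS lam D) L μ y
  set G := MσGAt 𝕜 ρ (Zf 𝕜 W V) (Zb 𝕜 W V) (βg lam D W V) (Zf 𝕜 0 0) (Zb 𝕜 0 0) 0 L μ y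
  set C := ι (lam r • D) * logT 𝕜 (PhiGAt 𝕜 ρ (Zf 𝕜 W V) (Zb 𝕜 W V) L μ y)
      - logT 𝕜 (PhiGAt 𝕜 ρ (Zf 𝕜 W V) (Zb 𝕜 W V) L μ y) * ι (lam r • D)
  calc X = (A + C) - (A - X + G) + G - C := by abel
    _ = (A - X + G) - (A - X + G) + G - C := by rw [← h3]
    _ = G - C := by abel


/-! ## §5 The Ward identity of the `τ₁τ₂σ`-coefficient in counts -/

section Counts

open Classical in
/-- [our object] The `τ₁`-component of the rotation defect: `β₁ = [a, W]`, `a = λ(x)·D`. -/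
def βg1 (W : Form1 d 𝔸) : Form1 d 𝔸 := fun κ x => (lam x • D) * W κ x - W κ x * (lam x • D)

/-- [our object] The `τ₂`-component: `β₂ = [a, V]`. -/
def βg2 (V : Form1 d 𝔸) : Form1 d 𝔸 := fun κ x => (lam x • D) * V κ x - V κ x * (lam x • D)

/-- [our object] The `τ₁τ₂`-component: `β₃ = h·a + a·h − W a V − V a W`, `h = ½(WV + VW)`. -/
noncomputable def βg3 (W V : Form1 d 𝔸) : Form1 d 𝔸 := fun κ x =>
  (2 : 𝕜)⁻¹ • (W κ x * V κ x + V κ x * W κ x) * (lam x • D) + (lam x • D) * ((2 : 𝕜)⁻¹ • (W κ x * V κ x + V κ x * W κ x))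
    - W κ x * (lam x • D) * V κ x - V κ x * (lam x • D) * W κ x

/-- [folklore] **THE ROTATION DEFECT IN COMPONENTS**: `βg = τ₁·ι β₁ + τ₂·ι β₂ + τ₁τ₂·ι β₃` (MX1's `Zb_mul_ι_mul_Zf` + 33M2's `mk_sub_ι`). -/
theorem βg_eq (W V : Form1 d 𝔸) :
    βg lam D W V
      = (fun κ x => τ₁ * ι (βg1 lam D W κ x)) + (fun κ x => τ₂ * ι (βg2 lam D V κ x))
          + (fun κ x => τ12 * ι (βg3 (𝕜 := 𝕜) lam D W V κ x)) := by
  funext κ x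
  rw [βg, Zb_mul_ι_mul_Zf, mk_sub_ι]
  rfl

/-- [folklore] **THE CONTACT EXPANSION OF THE ROTATION RESPONSE** (the twin of 33M2's `c11_MσGAt_DR` for the gauge defect). -/
theorem c11_MσGAt_βg (ρ : Fin d → ℤ) (Z Zb' Z₀ Zb₀ : Form1 d (Tau 𝔸)) (W V : Form1 d 𝔸) (L : ℕ) (μ : Fin d) (y : Fin d → ℤ) :
    c11 (MσGAt 𝕜 ρ Z Zb' (βg lam D W V) Z₀ Zb₀ 0 L μ y)
      = c01 (MσGAt 𝕜 ρ Z Zb' (upF (βg1 lam D W)) Z₀ Zb₀ 0 L μ y)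
        + c10 (MσGAt 𝕜 ρ Z Zb' (upF (βg2 lam D V)) Z₀ Zb₀ 0 L μ y)
        + c00 (MσGAt 𝕜 ρ Z Zb' (upF (βg3 (𝕜 := 𝕜) lam D W V)) Z₀ Zb₀ 0 L μ y) := by
  have e1 : (fun κ x => τ₁ * ι (βg1 lam D W κ x)) = fun κ x => τ₁ * upF (βg1 lam D W) κ x := rfl
  have e2 : (fun κ x => τ₂ * ι (βg2 lam D V κ x)) = fun κ x => τ₂ * upF (βg2 lam D V) κ x := rfl
  have e3 : (fun κ x => τ12 * ι (βg3 (𝕜 := 𝕜) lam D W V κ x)) = fun κ x => τ12 * upF (βg3 (𝕜 := 𝕜) lam D W V) κ x := rfl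
  rw [βg_eq, MσGAt_add_zero, MσGAt_add_zero, e1, e2, e3, MσGAt_mul_central_zero τ₁ τ₁_comm, MσGAt_mul_central_zero τ₂ τ₂_comm,
    MσGAt_mul_central_zero τ12 τ12_comm, c11_add, c11_add, c11_τ₁_mul, c11_τ₂_mul, c11_τ12_mul]

/-- [folklore] The pure-gauge background letter IS the lift of the scalar family `(dλ)•D` (by `rfl`). -/
theorem dS_eq_upF : dS lam D = upF (fun κ x => (lam (x + unitVec κ) - lam x) • D) := rfl

/-- [folklore] **THE JET WARD IDENTITY OF node 12b's ROOTED MIXED JET, IN COUNTS** (`(L:𝕜) ≠ 0`, characteristic ≠ 2): for the pure-gauge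
background `(dλ)_f·D`,
`M^ρ_b(W, V; dλ·D) = (2L^d)⁻¹•(hessUAt ρ V β₁ + linAvgAt ρ [V, β₁] + hessUAt ρ W β₂ + linAvgAt ρ [W, β₂]) + L^{-d}•linAvgAt ρ β₃ − (a_r·H − H·a_r)`,
`a_r = λ(r)·D` at the ROOT `r = L·y + ρ`, `H = (2L^d)⁻¹•hessUAt ρ W V` (33M3a), `β₁ = [a,W]`, `β₂ = [a,V]`, `β₃ = ha + ah − WaV − VaW`. -/
theorem MjetAt_gauge_counts {L : ℕ} (hL : (L : 𝕜) ≠ 0) (h2 : (2 : 𝕜) ≠ 0) (ρ : Fin d → ℤ) (W V : Form1 d 𝔸) (μ : Fin d)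
    (y : Fin d → ℤ) :
    MjetAt 𝕜 ρ W V (fun κ x => (lam (x + unitVec κ) - lam x) • D) L μ y
      = ((2 : 𝕜) * (L : 𝕜) ^ d)⁻¹ •
            (hessUAt ρ V (βg1 lam D W) L μ y + linAvgAt ρ (bw V (βg1 lam D W)) L μ y)
        + ((2 : 𝕜) * (L : 𝕜) ^ d)⁻¹ •
            (hessUAt ρ W (βg2 lam D V) L μ y + linAvgAt ρ (bw W (βg2 lam D V)) L μ y)
        + ((L : 𝕜) ^ d)⁻¹ • linAvgAt ρ (βg3 (𝕜 := 𝕜) lam D W V) L μ y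
        - ((lam ((L : ℤ) • y + ρ) • D) * (((2 : 𝕜) * (L : 𝕜) ^ d)⁻¹ • hessUAt ρ W V L μ y)
            - (((2 : 𝕜) * (L : 𝕜) ^ d)⁻¹ • hessUAt ρ W V L μ y) * (lam ((L : ℤ) • y + ρ) • D)) := by
  rw [MjetAt_eq_MjetLAt, MjetLAt_eq_c11, MσLAt_eq_MσGAt, ← MσLAt_eq_MσGAt, ← dS_eq_upF, MσLAt_dS lam D h2 ρ W V (upF 0) L μ y,
    c11_sub, c11_MσGAt_βg, c01_MσGAt_contact ρ W V _ hL h2, c10_MσGAt_contact ρ W V _ hL h2, c00_MσGAt_contact ρ W V _ hL,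
    c11_sub, c11_ι_mul, c11_mul_ι, c11_logT_PhiGAt_Zf ρ W V hL h2]

end Counts

end Summit.QuantumFields.BalabanUV.Beta.MixedJetWard
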